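import Summits.NavierStokesRegularity.NavierStokesRegularity.Theorems.ScalingDefectPeepholeDoorPressureGauge
import Summits.NavierStokesRegularity.NavierStokesRegularity.Theorems.PeepholeVorticityDoorFramePressure
import Literature.Analysis.FluidPDE.PineauVicolOneSliceGradient
import Literature.Analysis.FluidPDE.TaoLocalisation
import Literature.Analysis.FluidPDE.ClassicalNSIRescale

/-!
# ScalingDefectPeepholeDoorAnnularPressure — door S30 «ScalingDefectPeepholeDoor», plate P4 (frame) part 2, FINAL:
# `annularPressureBoundS30_holds : AnnularPressureBoundS30` and `frameTransferS30_holds : FrameTransferS30` (ns-s29-p2 g2)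

The pointwise (1.16) pressure bound on the window annulus (`ScalingDefectPeepholeDoorFrame.AnnularPressureBoundS30`).  Since the
window scale `β` (hence `λ = √(νβ)`, `δ = λ/8`) is chosen from the CLASS data `(ν, M, T, ρ, E₀)` BEFORE the solution, every
constant below is a fixed number:

1. FRAME.  `β₀ = min(T/2, ρ²/(4(ν+1)))`, `Λ = √(νβ₀) < ρ` (S29 `PeepholeVorticityDoorFrame`); in the Pineau–Vicol frame
   `v = (Λ/ν) u(T + β₀·, x₀ + Λ·)` local Type I becomes `|v| ≤ C_u/(√(−s)+|y|)` (`pv_typeI_transfer`), the `L³` level is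
   `B_u(C_u)` (`lintegral_typeI_cube_le`) and the gauged pressure level is the class constant `K_p` (`exists_pressure_gauge_point`,
   `lintegral_pv_pressure_le`); `exists_forall_fderiv_le_of_typeI_of_bounds` then gives `‖Dv‖ ≤ K_g/(|y|+√(−s))²` on the cone
   `|y| + √(−s) ≤ c₁(B_u, K_p)`.
2. WINDOW.  `λ = Λ·min(1/2, c₁/3)`, `β = λ²/ν`: the `δ`-balls around the physical annulus `λ/2 < |y−x₀| < 3λ/4` at times
   `t ∈ (T−2β, T)` lie in that cone and at distance `≥ 3λ/8` from `x₀`, so `|u| ≤ M₀ = |M|/(3λ/8)` (Type I) and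
   `‖Du‖ ≤ M₁ = (Λ²/ν)⁻¹ K_g/(3λ/(8Λ))²` there (`fderiv_smul_stPull_slice`).
3. PRESSURE.  `abs_normalisedPressure_le_weighted_scale` + `weightedFar_le_of_energy` (`∫|u(t)|² ≤ 2E₀`, Leray–Hopf):
   `|p̃[u(t)](y)| ≤ B` on the annulus; the gauge step `abs_pressure_sub_le_of_normalisedPressure_le` turns it into
   `|p(t,x) − p(t,x₁)| ≤ 2B` for ALL `t ∈ [T−β, T)` with `x₁ = x₀ + λ(5/8)e₀`; times `(λ/ν)²` this is `C_p`.

Door S30 is a regularity CRITERION (item 0056 `NoTypeII` stays OPEN); with this file the chain to `TargetVortexDefectPeephole` BY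
NAME waits only on K1ω `VortexDefectTubeBound` (and P3 `QuietVortexCoreRigidity` landing).
-/

noncomputable section

set_option linter.dupNamespace false

namespace Summit.NavierStokesRegularity.NavierStokesRegularity.Theorems.ScalingDefectPeepholeDoor

open MeasureTheory Set Function Filter Topology TopologicalSpace Metric
open scoped NNReal ENNReal
open Literature.Analysis Literature.Analysis.FluidPDE
open Summit.NavierStokesRegularity.NavierStokesRegularity.Theorems.PeepholeVorticityDoor
open Summit.NavierStokesRegularity.NavierStokesRegularity.Theorems.StableStrataDoorClassSlabLevels

-- nested operator types
set_option maxSynthPendingDepth 3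

/-- **Plate P4 part 2: the pointwise (1.16) pressure bound on the window annulus.** -/
theorem annularPressureBoundS30_holds : AnnularPressureBoundS30 := by
  intro ν hν M T ρ E₀ hT hρ
  /- §1 the frame scale `β₀`, `Λ = √(νβ₀)` (as in S29) -/
  set β₀ : ℝ := min (T / 2) (ρ ^ 2 / (4 * (ν + 1))) with hβ₀_def
  have hβ₀ : 0 < β₀ := lt_min (by positivity) (by positivity)
  have hβ₀T2 : β₀ ≤ T / 2 := min_le_left _ _
  have hβ₀T : β₀ < T := by linarith
  have hβ₀ρ : β₀ ≤ ρ ^ 2 / (4 * (ν + 1)) := min_le_right _ _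
  have hρ4 : ρ ^ 2 / (4 * (ν + 1)) ≤ ρ ^ 2 / 4 :=
    div_le_div_of_nonneg_left (sq_nonneg ρ) (by norm_num) (by linarith)
  have hβ₀ρ' : β₀ < ρ ^ 2 := by nlinarith
  set Λ : ℝ := Real.sqrt (ν * β₀) with hΛ_def
  have hΛ : 0 < Λ := Real.sqrt_pos.2 (by positivity)
  have hΛ2 : Λ ^ 2 = ν * β₀ := Real.sq_sqrt (by positivity)
  have hΛρ : Λ < ρ := by
    have h1 : ν * (ρ ^ 2 / (4 * (ν + 1))) ≤ ρ ^ 2 / 4 := by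
      rw [mul_div_assoc', div_le_div_iff₀ (by positivity) (by positivity)]
      nlinarith [sq_nonneg ρ]
    have h2 : Λ ^ 2 < ρ ^ 2 := by
      have : ν * β₀ ≤ ν * (ρ ^ 2 / (4 * (ν + 1))) := by gcongr
      nlinarith
    exact lt_of_pow_lt_pow_left₀ 2 hρ.le h2
  set Cu : ℝ := |M| / ν + 1 with hCu_def
  have hCu : 0 < Cu := by positivity
  have hMCu : M / ν ≤ Cu := by
    have h1 : M / ν ≤ |M| / ν := div_le_div_of_nonneg_right (le_abs_self M) hν.le
    linarith
  /- §2 the class pressure level `K_p` and the `L³` level `B_u` -/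
  set P : ℝ≥0∞ := 2 ^ (3 / 2 : ℝ) * ((steinConstThreeHalves : ℝ≥0∞) ^ (3 / 2 : ℝ) *
        (ENNReal.ofReal (2 * E₀) ^ (3 / 4 : ℝ) *
          ((SNormLESNormFDerivOfEqConst (EuclideanSpace ℝ (Fin 3))
              (volume : Measure (EuclideanSpace ℝ (Fin 3))) 2 : ℝ≥0∞) ^ (3 / 2 : ℝ) *
            (ENNReal.ofReal T + ENNReal.ofReal (E₀ / ν))))) with hP_def
  have hPt : P ≠ ⊤ := by
    have h1 : (2 : ℝ≥0∞) ^ (3 / 2 : ℝ) ≠ ⊤ := ENNReal.rpow_ne_top_of_nonneg (by norm_num) ENNReal.ofNat_ne_top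
    have h2 : (steinConstThreeHalves : ℝ≥0∞) ^ (3 / 2 : ℝ) ≠ ⊤ :=
      ENNReal.rpow_ne_top_of_nonneg (by norm_num) ENNReal.coe_ne_top
    have h3 : ENNReal.ofReal (2 * E₀) ^ (3 / 4 : ℝ) ≠ ⊤ :=
      ENNReal.rpow_ne_top_of_nonneg (by norm_num) ENNReal.ofReal_ne_top
    have h4 : ((SNormLESNormFDerivOfEqConst (EuclideanSpace ℝ (Fin 3))
        (volume : Measure (EuclideanSpace ℝ (Fin 3))) 2 : ℝ≥0∞)) ^ (3 / 2 : ℝ) ≠ ⊤ :=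
      ENNReal.rpow_ne_top_of_nonneg (by norm_num) ENNReal.coe_ne_top
    have h5 : ENNReal.ofReal T + ENNReal.ofReal (E₀ / ν) ≠ ⊤ :=
      ENNReal.add_ne_top.2 ⟨ENNReal.ofReal_ne_top, ENNReal.ofReal_ne_top⟩
    exact ENNReal.mul_ne_top h1 (ENNReal.mul_ne_top h2 (ENNReal.mul_ne_top h3 (ENNReal.mul_ne_top h4 h5)))
  set Kp : ℝ≥0∞ := ENNReal.ofReal (β₀ * Λ ^ 3)⁻¹ * (‖(Λ / ν) ^ 2‖ₑ ^ (3 / 2 : ℝ) * P) with hKp_def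
  have hKpt : Kp ≠ ⊤ :=
    ENNReal.mul_ne_top ENNReal.ofReal_ne_top (ENNReal.mul_ne_top
      (ENNReal.rpow_ne_top_of_nonneg (by norm_num) enorm_ne_top) hPt)
  set Tq : ℝ≥0∞ := ∫⁻ t in Ioo (-1 : ℝ) 0, ENNReal.ofReal ((-t) ^ (-(1 / 4 : ℝ))) with hTq
  set Xq : ℝ≥0∞ := ∫⁻ x in ball (0 : EuclideanSpace ℝ (Fin 3)) 1,
    ENNReal.ofReal (‖x‖ ^ (-(5 / 2 : ℝ))) with hXq
  set Bu : ℝ≥0∞ := ENNReal.ofReal (Cu ^ 3) * (Tq * Xq) with hBu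
  have hBut : Bu < ⊤ := ENNReal.mul_lt_top ENNReal.ofReal_lt_top
    (ENNReal.mul_lt_top lintegral_Ioo_neg_rpow_quarter_lt_top lintegral_ball_norm_rpow_lt_top)
  /- §3 the gradient envelope constants `K_g`, `c₁` -/
  obtain ⟨Kg, hKg0, HK⟩ := exists_forall_fderiv_le_of_typeI_of_bounds Cu
  obtain ⟨c₁, hc₁, Hgrad⟩ := HK Bu (Kp.toNNReal : ℝ≥0∞) hBut ENNReal.coe_lt_top
  /- §4 the window scale `λ = Λ θ`, `θ = min(1/2, c₁/3)`, `β = λ²/ν` -/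
  set θ : ℝ := min (1 / 2) (c₁ / 3) with hθ_def
  have hθ0 : 0 < θ := lt_min (by norm_num) (by positivity)
  have hθh : θ ≤ 1 / 2 := min_le_left _ _
  have hθc : θ ≤ c₁ / 3 := min_le_right _ _
  set lam : ℝ := Λ * θ with hlam_def
  have hlam : 0 < lam := mul_pos hΛ hθ0
  have hlamΛ : lam ≤ Λ / 2 := by rw [hlam_def]; nlinarith only [hθh, hΛ]
  have hlamρ : lam < ρ := by linarith only [hlamΛ, hΛρ, hΛ]
  set β : ℝ := lam ^ 2 / ν with hβ_def
  have hβ : 0 < β := by positivity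
  have hνβ : ν * β = lam ^ 2 := by rw [hβ_def, mul_div_cancel₀ _ hν.ne']
  have hsqrt : Real.sqrt (ν * β) = lam := by rw [hνβ, Real.sqrt_sq hlam.le]
  have hβeq : β = β₀ * θ ^ 2 := by
    rw [hβ_def, hlam_def, mul_pow, hΛ2]
    field_simp
  have hθ2 : θ ^ 2 ≤ 1 / 4 := by nlinarith only [hθh, hθ0]
  have hββ₀ : β ≤ β₀ / 4 := by rw [hβeq]; nlinarith only [hθ2, hβ₀]
  have hβT : β < T := by linarith only [hββ₀, hβ₀T2, hT]
  have hβρ : β < ρ ^ 2 := by linarith only [hββ₀, hβ₀ρ', hβ₀]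
  /- §5 the constants of the bound -/
  set δ : ℝ := lam / 8 with hδ_def
  have hδ : 0 < δ := by positivity
  set M₀ : ℝ := |M| / (3 * lam / 8) with hM₀_def
  have hM₀0 : 0 ≤ M₀ := by positivity
  set M₁ : ℝ := (Λ / ν * Λ)⁻¹ * (Kg / (3 * lam / (8 * Λ)) ^ 2) with hM₁_def
  have hM₁0 : 0 ≤ M₁ := by positivity
  set B : ℝ := M₀ ^ 2 / 3 + 8 * M₀ * M₁ * δ + (2 * Real.pi)⁻¹ * ((δ ^ 3)⁻¹ * (2 * |E₀|)) with hB_def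
  have hB0 : 0 ≤ B := by positivity
  set Cp : ℝ := (lam / ν) ^ 2 * (2 * B) + 1 with hCp_def
  have hCp : 0 < Cp := by positivity
  refine ⟨Cp, hCp, β, hβ, hβT, hβρ, by rw [hsqrt]; exact hlamρ, ?_⟩
  intro u p hsol hLH _ hE x₀ hM
  /- §6 the frame solution and its gradient envelope -/
  obtain ⟨x₁', -, hx₁'⟩ := exists_pressure_gauge_point hν hT hsol hLH hE (a := T - β₀) (by linarith only [hβ₀T]) x₀ hΛ
  set v : ℝ → EuclideanSpace ℝ (Fin 3) → EuclideanSpace ℝ (Fin 3) := (Λ / ν) • stPull β₀ Λ T x₀ u with hv_def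
  set q : ℝ → EuclideanSpace ℝ (Fin 3) → ℝ :=
    (Λ / ν) ^ 2 • stPull β₀ Λ T x₀ (fun t x => p t x - p t x₁') with hq_def
  have hreg : IsClassicalNSSolutionOnRegion
      (Ico (-1 : ℝ) 0 ×ˢ ball (0 : EuclideanSpace ℝ (Fin 3)) 1) 1 0 v q :=
    pvFrame_isClassical hν hsol hβ₀ hβ₀T x₀ x₁'
  have hI : ∀ s ∈ Ico (-1 : ℝ) 0, ∀ z ∈ ball (0 : EuclideanSpace ℝ (Fin 3)) 1,
      ‖v s z‖ ≤ Cu / (Real.sqrt (-s) + ‖z‖) :=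
    pv_typeI_transfer hν hβ₀T hβ₀ρ' hΛ hΛ2 hΛρ hMCu hM
  have hP : ∫⁻ w in Ioo (-1 : ℝ) 0 ×ˢ ball (0 : EuclideanSpace ℝ (Fin 3)) 1,
      ‖q w.1 w.2‖ₑ ^ (3 / 2 : ℝ) ≤ (Kp.toNNReal : ℝ≥0∞) := by
    rw [ENNReal.coe_toNNReal hKpt, hKp_def, hq_def]
    refine (lintegral_pv_pressure_le hβ₀ hΛ (Λ / ν) T x₀ x₁' p).trans ?_
    exact mul_le_mul_right (mul_le_mul_right hx₁' _) _
  have hBu_v : ∫⁻ w in Ioo (-1 : ℝ) 0 ×ˢ ball (0 : EuclideanSpace ℝ (Fin 3)) 1,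
      ‖v w.1 w.2‖ₑ ^ (3 : ℕ) ≤ Bu := by
    refine le_trans (le_of_eq (lintegral_congr fun w => ?_)) (lintegral_typeI_cube_le hI)
    rw [← ofReal_norm, ENNReal.ofReal_pow (norm_nonneg _)]
  have hP32 : ∫⁻ w in Ioo (-1 : ℝ) 0 ×ˢ ball (0 : EuclideanSpace ℝ (Fin 3)) (1 / 32),
      ‖q w.1 w.2‖ₑ ^ (3 / 2 : ℝ) ≤ (Kp.toNNReal : ℝ≥0∞) :=
    (lintegral_mono_set (prod_mono Subset.rfl (ball_subset_ball (by norm_num)))).trans hP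
  have hgrad : ∀ S ∈ Ioo (-1 : ℝ) 0, ∀ X : EuclideanSpace ℝ (Fin 3), ‖X‖ + Real.sqrt (-S) ≤ c₁ →
      ‖fderiv ℝ (v S) X‖ ≤ Kg / (‖X‖ + Real.sqrt (-S)) ^ 2 :=
    fun S hS X hX => Hgrad v q hreg hI hBu_v hP32 S hS X hX
  /- §7 the witness `x₁` and the physical annulus -/
  set e : EuclideanSpace ℝ (Fin 3) := EuclideanSpace.single 0 (5 / 8 : ℝ) with he_def
  have he : ‖e‖ = 5 / 8 := by
    rw [he_def, PiLp.norm_single, Real.norm_of_nonneg (by norm_num)]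
  refine ⟨x₀ + lam • e, ?_⟩
  set A : Set (EuclideanSpace ℝ (Fin 3)) := {y | lam / 2 < ‖y - x₀‖ ∧ ‖y - x₀‖ < 3 * lam / 4} with hA_def
  have hT2β : 0 ≤ T - 2 * β := by linarith only [hββ₀, hβ₀T2, hT]
  /- §8 KEY CLAIM: `|p̃[u(t')](y)| ≤ B` for `t' ∈ (T − 2β, T)`, `y ∈ A` -/
  have KC : ∀ t' ∈ Ioo (T - 2 * β) T, ∀ y ∈ A, |normalisedPressure (u t') y| ≤ B := by
    intro t' ht' y hy
    have ht'I : t' ∈ Ico 0 T := ⟨by linarith only [ht'.1, hT2β], ht'.2⟩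
    have ht'ρ : T - ρ ^ 2 < t' := by linarith only [ht'.1, hββ₀, hβ₀ρ', hβ₀]
    have hC1 : ContDiff ℝ 1 (u t') := (hsol.contDiff_velocity ht'I).of_le (by exact_mod_cast le_top)
    have hEn : (∫⁻ x, ‖u t' x‖ₑ ^ 2) ≤ ENNReal.ofReal (2 * VectorCalculus.kineticEnergy (u 0)) :=
      hLH.lintegral_enorm_sq_le hν.le ⟨ht'I.1, ht'I.2.le⟩
    have hEn' : (∫⁻ x, ‖u t' x‖ₑ ^ 2) ≤ ENNReal.ofReal (2 * |E₀|) :=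
      hEn.trans (ENNReal.ofReal_le_ofReal (by linarith only [le_abs_self E₀, hE]))
    have hEt : (∫⁻ x, ‖u t' x‖ₑ ^ 2) < ⊤ := lt_of_le_of_lt hEn ENNReal.ofReal_lt_top
    -- distances on the `δ`-ball around `y`
    have hball : ∀ y' ∈ closedBall y δ, 3 * lam / 8 ≤ ‖y' - x₀‖ ∧ ‖y' - x₀‖ ≤ 7 * lam / 8 := by
      intro y' hy'
      rw [mem_closedBall, dist_eq_norm] at hy'
      have h1 : ‖y - x₀‖ ≤ ‖y - y'‖ + ‖y' - x₀‖ := norm_sub_le_norm_sub_add_norm_sub _ _ _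
      have h2 : ‖y' - x₀‖ ≤ ‖y' - y‖ + ‖y - x₀‖ := norm_sub_le_norm_sub_add_norm_sub _ _ _
      rw [norm_sub_rev y y'] at h1
      constructor
      · linarith only [hy.1, h1, hy', hδ_def]
      · linarith only [hy.2, h2, hy', hδ_def]
    -- `M₀` from Type I
    have hM₀ : ∀ y' ∈ closedBall y δ, ‖u t' y'‖ ≤ M₀ := by
      intro y' hy'
      obtain ⟨hlo, hhi⟩ := hball y' hy'
      have hy'ρ : y' ∈ ball x₀ ρ := by
        rw [mem_ball, dist_eq_norm]; linarith only [hhi, hlamρ, hlam]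
      have key := hM t' ht'I ht'ρ y' hy'ρ
      have h1 : ‖u t' y'‖ * (3 * lam / 8) ≤ |M| :=
        calc ‖u t' y'‖ * (3 * lam / 8) ≤ ‖u t' y'‖ * (‖y' - x₀‖ + Real.sqrt (ν * (T - t'))) :=
              mul_le_mul_of_nonneg_left (hlo.trans (le_add_of_nonneg_right (Real.sqrt_nonneg _))) (norm_nonneg _)
          _ ≤ M := key
          _ ≤ |M| := le_abs_self M
      rw [hM₀_def, le_div_iff₀ (by positivity)]
      exact h1
    -- `M₁` from the gradient envelope in the frame
    have hM₁ : ∀ y' ∈ closedBall y δ, ‖fderiv ℝ (u t') y'‖ ≤ M₁ := by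
      intro y' hy'
      obtain ⟨hlo, hhi⟩ := hball y' hy'
      set X : EuclideanSpace ℝ (Fin 3) := Λ⁻¹ • (y' - x₀) with hX_def
      set S : ℝ := (t' - T) / β₀ with hS_def
      have hyX : x₀ + Λ • X = y' := by
        rw [hX_def, smul_smul, mul_inv_cancel₀ hΛ.ne', one_smul, add_sub_cancel]
      have htS : T + β₀ * S = t' := by
        rw [hS_def, mul_div_cancel₀ _ hβ₀.ne']; ring
      have hXn : ‖X‖ = ‖y' - x₀‖ / Λ := by
        rw [hX_def, norm_smul, norm_inv, Real.norm_of_nonneg hΛ.le, div_eq_inv_mul]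
      have hnegS' : -S = (T - t') / β₀ := by rw [hS_def]; ring
      have hS0 : 0 < -S := by
        rw [hnegS']
        exact div_pos (by linarith only [ht'.2]) hβ₀
      have hSm : S ∈ Ioo (-1 : ℝ) 0 := by
        refine ⟨?_, by linarith only [hS0]⟩
        rw [hS_def, lt_div_iff₀ hβ₀]
        linarith only [ht'.1, hββ₀, hβ₀]
      have hXlo : 3 * lam / (8 * Λ) ≤ ‖X‖ := by
        rw [hXn, div_le_div_iff₀ (by positivity) hΛ]
        have := mul_le_mul_of_nonneg_right hlo hΛ.le
        linarith only [this]
      have hXhi : ‖X‖ ≤ 7 * lam / (8 * Λ) := by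
        rw [hXn, div_le_div_iff₀ hΛ (by positivity)]
        have := mul_le_mul_of_nonneg_right hhi hΛ.le
        linarith only [this]
      -- `√(−S) ≤ 3θ/2` since `−S < 2β/β₀ = 2θ²`
      have hnegS : -S ≤ 2 * θ ^ 2 := by
        rw [hnegS', div_le_iff₀ hβ₀]
        have h2 : T - t' < 2 * β := by linarith only [ht'.1]
        rw [hβeq] at h2
        linarith only [h2]
      have hsqS : Real.sqrt (-S) ≤ 3 * θ / 2 := by
        calc Real.sqrt (-S) ≤ Real.sqrt ((3 * θ / 2) ^ 2) :=
              Real.sqrt_le_sqrt (by nlinarith only [hnegS, sq_nonneg θ])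
          _ = 3 * θ / 2 := Real.sqrt_sq (by positivity)
      have hlamθ : lam / Λ = θ := by rw [hlam_def]; field_simp
      have hcone : ‖X‖ + Real.sqrt (-S) ≤ c₁ := by
        have h1 : 7 * lam / (8 * Λ) = 7 / 8 * θ := by rw [← hlamθ]; field_simp
        rw [h1] at hXhi
        linarith only [hXhi, hsqS, hθc, hθ0]
      have hg := hgrad S hSm X hcone
      have hpos : 0 < 3 * lam / (8 * Λ) := by positivity
      have hg' : ‖fderiv ℝ (v S) X‖ ≤ Kg / (3 * lam / (8 * Λ)) ^ 2 := by
        refine hg.trans (div_le_div_of_nonneg_left hKg0 (by positivity) ?_)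
        exact pow_le_pow_left₀ hpos.le (hXlo.trans (le_add_of_nonneg_right (Real.sqrt_nonneg _))) 2
      -- `Dv(S,X) = (Λ²/ν) Du(t',y')`
      have hd : Differentiable ℝ (u (T + β₀ * S)) := by
        rw [htS]; exact (hsol.contDiff_velocity ht'I).differentiable (by simp)
      have hfd := fderiv_smul_stPull_slice (α := Λ / ν) (β := β₀) (γ := Λ) (t₀ := T) (x₀ := x₀) (u := u) (s := S) hd X
      rw [htS, hyX] at hfd
      have hvS : fderiv ℝ (v S) X = (Λ / ν * Λ) • fderiv ℝ (u t') y' := by rw [hv_def]; exact hfd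
      have hαpos : 0 < Λ / ν * Λ := by positivity
      have hnorm : ‖fderiv ℝ (u t') y'‖ = (Λ / ν * Λ)⁻¹ * ‖fderiv ℝ (v S) X‖ := by
        rw [hvS, norm_smul, Real.norm_of_nonneg hαpos.le, ← mul_assoc, inv_mul_cancel₀ hαpos.ne', one_mul]
      rw [hnorm, hM₁_def]
      exact mul_le_mul_of_nonneg_left hg' (by positivity)
    -- the far field and the Stein bound
    have hfar := weightedFar_le_of_energy hC1.continuous (abs_nonneg E₀) hEn' y hδ
    have hmain := abs_normalisedPressure_le_weighted_scale hC1 hEt y hδ hM₀ hM₁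
    calc |normalisedPressure (u t') y|
        ≤ M₀ ^ 2 / 3 + 8 * M₀ * M₁ * δ + (2 * Real.pi)⁻¹ * ∫ y' in (closedBall y δ)ᶜ, ‖u t' y'‖ ^ 2 / ‖y - y'‖ ^ 3 := hmain
      _ ≤ M₀ ^ 2 / 3 + 8 * M₀ * M₁ * δ + (2 * Real.pi)⁻¹ * ((δ ^ 3)⁻¹ * (2 * |E₀|)) := by
          gcongr
      _ = B := rfl
  /- §9 the gauge step and the evaluation at `t = T + βs`, `x = x₀ + λz` -/
  have hG := abs_pressure_sub_le_of_normalisedPressure_le hν hT hsol hLH (a := T - 2 * β) (b := T) hT2β le_rfl KC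
  intro s hs z hz1 hz2
  have ht : T + β * s ∈ Ioo (T - 2 * β) T := ⟨by nlinarith only [hs.1, hβ], by nlinarith only [hs.2, hβ]⟩
  have hxA : x₀ + lam • z ∈ A := by
    simp only [hA_def, mem_setOf_eq, add_sub_cancel_left, norm_smul, Real.norm_of_nonneg hlam.le]
    exact ⟨by nlinarith only [hz1, hlam], by nlinarith only [hz2, hlam]⟩
  have hx₁A : x₀ + lam • e ∈ A := by
    simp only [hA_def, mem_setOf_eq, add_sub_cancel_left, norm_smul, Real.norm_of_nonneg hlam.le, he]
    exact ⟨by linarith only [hlam], by linarith only [hlam]⟩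
  have key := hG (T + β * s) ht (x₀ + lam • z) hxA (x₀ + lam • e) hx₁A
  rw [hsqrt]
  rw [smul_stPull_apply, smul_eq_mul, abs_mul, abs_of_nonneg (sq_nonneg _)]
  calc (lam / ν) ^ 2 * |p (T + β * s) (x₀ + lam • z) - p (T + β * s) (x₀ + lam • e)|
      ≤ (lam / ν) ^ 2 * (2 * B) := mul_le_mul_of_nonneg_left key (sq_nonneg _)
    _ ≤ Cp := by rw [hCp_def]; exact le_add_of_nonneg_right zero_le_one

/-- **Plate P4 complete: the frame transfer `FrameTransferS30`.** -/
theorem frameTransferS30_holds : FrameTransferS30 :=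
  frameTransferS30_of_annularPressure annularPressureBoundS30_holds

end Summit.NavierStokesRegularity.NavierStokesRegularity.Theorems.ScalingDefectPeepholeDoor

end
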